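import Summits.QuantumFields.BalabanUV.Beta.BorderedHessianStep

/-!
# (J1), FIELD BLOCK: the value Hessian `E2 d Lc j` (the multiplier response `wΦ` of the level-`Lc^j` packed resolvent, read on the
# step lattice) is BLIND to the block-mean axial dressing on BOTH sides — `E2 ∘ Π̂_bmᵀ = E2 = Π̂_bm ∘ E2`
# (β sub-cell, row BETA-an2 = BINDER-OWNERS row D1, gen 15; leaf (L1)/(J1) of the hR skeleton `gen14/D1-hR-SKELETON.md`, AN2 §40.7 (d))

HONEST FRAMING (cell charter, verbatim): «discharging BetaPertH makes Balaban's UV stability UNCONDITIONAL — a real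
constructive-QFT result; it is NOT the continuum limit and NOT the Clay problem.»  DERIVED cell leaf (pub-balaban β sub-cell, lane
an2 gen 15); no statement of Bałaban's papers is typed here, no `[cite:]` tag, no `Prop` fact; it instantiates no binder of the
β-function wall by itself.  It proves ONE of the four sub-leaves ((J1) border / (J1) field / (J2) marginal residual / (J3) absorption) of
the OPEN binder «rules 3–4 of `RelInv` for the candidate step Hessian `bhKStepAt` at `j ≥ 1`»; NOTHING is claimed about (J2)/(J3).
NOT `BetaPertH`; NOT continuum; NOT Clay.

## The mechanism (elementary; no uniqueness theorem, no Fourier analysis)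

The field block of the candidate `BorderedHessian.bhKStepAt d ρ Lc (j+1)` is `wVH · E2 d Lc (j+1)` with
`E2 d Lc j x′ z′ (inl κ) (inl l) = wΦ (N := Lc^j) κ l (x′ − z′)` (`E2_inl_inl_eq_wΦ`: `BalabanStepJetsSucc.mmRead` of
`OneStepResolventKernel.KInv` at the coarse points).  The multiplier response `wΦ` is
* CO-CLOSED IN ITS FIRST SLOT (`codiff₁_wΦ`): apply `codiff₁` to the gauge-free Euler–Lagrange identity of the minimiser column
  `d*d ℋ_l = 𝒬ᵀ wΦ_l` (`ResolventComposition.wH_EL'`, itself from an5's `wM_eq_zero`); `codiff₁ ∘ curvAdj = 0`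
  (`codiff₁_curvAdj`) and `codiff₁ (𝒬ᵀ φ) (N•y) = codiff₁ φ y` (`codiff₁_contourSumAdj`) — i.e. `wΦ` is the Hessian of a functional
  invariant under COARSE gauge transformations, read at the level of its kernel;
* SYMMETRIC (`GAN24.TransverseDictionary.wΦ_symm`), hence co-closed in its second slot too (`codiff₁_wΦ_right`);
* BOUNDED (`exists_abs_wΦ_le`, from `KernelSpecInstance.decay_wΦ`).
The field column of `Π̂_bm = trK (piKBm ρ L)` at `(inl β, z)` is `Π_bm δ_{(β,z)} = δ_{(β,z)} − d λ` with the EXPLICIT potential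
`λ = bmGaugeAt ρ δ_{(β,z)} L` (`AxialProjectorBlockMean.axProjBmAt` by definition), which is FINITELY SUPPORTED (§3: the rooted tree
integral of a bond indicator and its block mean live in the block of the bond, `AxialDressingRooted.treeGaugeAt_bondInd_ne_zero_blk` /
`blockSum_treeGaugeAt_bondInd_ne_zero`), hence summable; summation by parts (`KKTFluctuationEnergy.lip1_dz`) against a bounded co-closed
row kills `d λ` (§2 `tsum_mul_dz_eq_zero_of_codiff₁`).  Hence §4 `tsum_mul_piKBm_inl_inl` (any bounded co-closed coarse row is
reproduced by the field block of `Π̂_bm`) and §5 **`comp_E2_trK_piKBm : E2 d Lc j ∘ Π̂_bmᵀ = E2 d Lc j`**,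
**`comp_piKBm_E2 : Π̂_bm ∘ E2 d Lc j = E2 d Lc j`** (every `j`, every in-block root, any two blockings `Lc^j` / `Lc`).

This is the `j ≥ 1` analogue, for the FIELD block, of `BorderedHessianBlind.comp_bhK_trK_piKBm` (`d*d` kills gradients because
`curv ∘ d = 0`; here `wΦ` kills COARSE gradients because it is the kernel of a coarse-gauge-invariant Hessian) — the input (J1)-field of
the direct chain (J1)–(J3) for rules 3–4 at `j ≥ 1` (AN2 §40.7 (d); an4's transport schema does not apply: `E′·D ≠ D·E` for the comb
projectors).  All declarations `[folklore]`; axioms standard.  Provenance: b2b-balaban β sub-cell, unit beta-an2 gen 15, 2026-08-20 (v1);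
over `BorderedHessianStep` (hence `BorderedHessianBlind`, `AxialDressingRootedBm*`, `AxialProjectorBlockMean`, `GAN24.TransverseDictionary`,
`ResolventComposition`, `KernelSpecInstance`, `KKTFluctuationEnergy`, `BalabanStepJetsSucc`) BY NAME; no existing file touched.
-/

open Finset
open scoped BigOperators
open Literature.Probability.LatticeModels (TorusSite Torus.proj Torus.proj_apply)
open Literature.MathematicalPhysics.QuantumFieldTheory
open Literature.MathematicalPhysics.QuantumFieldTheory.Balaban1983to89
open Literature.MathematicalPhysics.QuantumFieldTheory.Balaban1983to89.Beta
open B12Sec2to5 (l1 l1_nonneg Decay510)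
open ExpKernelCalculus (MKer Decays comp)
open AffineAveraging (Form0 Form1 Form2 box toSite unitVec unitVec_apply dz curv curvAdj codiff₁ blockSum)
open AffineReproduction (contourSumAdj)
open AveragingContours (blk grad grad_eq_dz blk_block)
open AveragingContoursRooted (treeGaugeAt)
open AxialProjector (zsmul_blk_le lt_zsmul_blk_add)
open KKTFluctuationKernel (delta1 delta1_apply)
open KKTFluctuationEnergy (lip0 lip1 lip1_dz summable_mul_of_bdd summable_dz)
open KKTFluctuationUnique (abs_le_of_decay510)
open KernelSpecInstance (wH wΦ decay_wΦ)
open ResolventComposition (wH_EL' codiff₁_curvAdj codiff₁_contourSumAdj quo_zsmul')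
open LatticeForm (quo)
open OneStepResolventKernel (Fib KInv KInv_inr_inr_coarse)
open BalabanStepJetsSucc (E2 mmRead mmRead_inl_inl mmRead_inr_left mmRead_inr_right)
open Summit.QuantumFields.BalabanUV.Beta.TameKernelCalculus
open Summit.QuantumFields.BalabanUV.Beta.AxialDressingRooted (bondInd bondInd_apply piKBm piKBm_inl_inl piKBm_inl_inr piKBm_inr_inl
  piKBm_inr_inr treeGaugeAt_map treeGaugeAt_bondInd_ne_zero_blk blockSum_treeGaugeAt_bondInd_ne_zero one_le_of_neZero)
open Summit.QuantumFields.BalabanUV.Beta.AxialProjectorBlockMean (blockMeanAt bmGaugeAt axProjBmAt)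
open Summit.QuantumFields.BalabanUV.Beta.GAN24.TransverseDictionary (wΦ_symm)

namespace Summit.QuantumFields.BalabanUV.Beta.BorderedHessian

noncomputable section

variable {d : ℕ}

/-! ## §1 The multiplier response `wΦ` is co-closed in both slots and bounded -/

section Coclosed

variable {N : ℕ} [NeZero N]

/-- [folklore] **`wΦ` IS CO-CLOSED IN ITS FIRST SLOT**: `codiff₁ (κ, y ↦ wΦ κ l y) = 0` — `codiff₁` of the gauge-free Euler–Lagrange
identity `d*d ℋ_l = 𝒬ᵀ wΦ_l` of the minimiser column, read at the coarse points `N • y`. -/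
theorem codiff₁_wΦ (l : Fin (d + 1)) : codiff₁ (fun κ y => wΦ (N := N) κ l y) = 0 := by
  funext y
  have hEL : curvAdj (curv (fun κ z => wH (N := N) κ l z)) = contourSumAdj N (fun κ y => wΦ (N := N) κ l y) := by
    funext μ x
    exact wH_EL' (N := N) l μ x
  have h := congrArg codiff₁ hEL
  rw [codiff₁_curvAdj] at h
  have h' := congrFun h ((N : ℤ) • y)
  rw [Pi.zero_apply, codiff₁_contourSumAdj, quo_zsmul'] at h'
  rw [Pi.zero_apply]
  exact h'.symm

/-- [folklore] The translated first-slot statement: `codiff₁ (κ, y ↦ wΦ κ l (y − z)) = 0`. -/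
theorem codiff₁_wΦ_shift (l : Fin (d + 1)) (z : Fin (d + 1) → ℤ) :
    codiff₁ (fun κ y => wΦ (N := N) κ l (y - z)) = 0 := by
  funext y
  have h := congrFun (codiff₁_wΦ (N := N) (d := d) l) (y - z)
  simp only [codiff₁, Pi.zero_apply] at h ⊢
  have e : ∀ κ : Fin (d + 1), y - unitVec κ - z = y - z - unitVec κ := fun κ => by abel
  simp_rw [e]
  exact h

/-- [folklore] **`wΦ` IS CO-CLOSED IN ITS SECOND SLOT** (by the reciprocity `wΦ κ l v = wΦ l κ (−v)`):
`codiff₁ (l, y ↦ wΦ κ l (x − y)) = 0`. -/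
theorem codiff₁_wΦ_right (κ : Fin (d + 1)) (x : Fin (d + 1) → ℤ) :
    codiff₁ (fun l y => wΦ (N := N) κ l (x - y)) = 0 := by
  have e : (fun l y => wΦ (N := N) κ l (x - y)) = fun l y => wΦ (N := N) l κ (y - x) := by
    funext l y
    rw [wΦ_symm, neg_sub]
  rw [e]
  exact codiff₁_wΦ_shift κ x

/-- [folklore] `wΦ` is bounded, uniformly in both directions (it decays: `decay_wΦ`). -/
theorem exists_abs_wΦ_le : ∃ C : ℝ, ∀ (κ l : Fin (d + 1)) (y : Fin (d + 1) → ℤ), |wΦ (N := N) κ l y| ≤ C := by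
  obtain ⟨δ, C, hδ, h⟩ := decay_wΦ (N := N) (d := d)
  exact ⟨C, fun κ l y => abs_le_of_decay510 hδ (h κ l) y⟩

end Coclosed

/-! ## §2 A bounded co-closed row pairs to zero with the differential of a summable potential -/

/-- [folklore] SUMMATION BY PARTS: for a bounded co-closed 1-form `A` and a summable 0-form `g`,
`∑'_y ∑_l A_l(y) (d g)_l(y) = ∑'_y (codiff₁ A)(y) g(y) = 0`. -/
theorem tsum_mul_dz_eq_zero_of_codiff₁ {A : Form1 (d + 1) ℝ} {C : ℝ} (hA : ∀ l y, |A l y| ≤ C) (hco : codiff₁ A = 0)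
    {g : Form0 (d + 1) ℝ} (hg : Summable g) : ∑' y, ∑ l, A l y * dz g l y = 0 := by
  have h := lip1_dz hA hg
  unfold KKTFluctuationEnergy.lip1 KKTFluctuationEnergy.lip0 at h
  rw [h, hco]
  simp

/-! ## §3 The dressing potential of a bond indicator is finitely supported -/

section Potential

variable {N : ℕ}

/-- [folklore] The rooted tree integral of `δ_{(β,z)}` vanishes at every point at `ℓ^∞`-distance `≥ N` from `z` (in-block root). -/
theorem treeGaugeAt_delta1_eq_zero (hN : 1 ≤ N) {r : Fin (d + 1) → ℕ} (hr : r ∈ box (d + 1) N) {β : Fin (d + 1)}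
    {z p : Fin (d + 1) → ℤ} {j : Fin (d + 1)} (hj : (N : ℤ) ≤ |p j - z j|) :
    treeGaugeAt (toSite r) (delta1 β z) N p = 0 := by
  rw [← bondInd_cast_eq_delta1]
  have hcast : treeGaugeAt (toSite r) (fun κ w => (bondInd β z κ w : ℝ)) N p =
      ((treeGaugeAt (toSite r) (bondInd β z) N p : ℤ) : ℝ) :=
    treeGaugeAt_map (Int.castAddHom ℝ) (toSite r) (bondInd β z) N p
  rw [hcast]
  by_contra h
  have hz : treeGaugeAt (toSite r) (bondInd β z) N p ≠ 0 := fun e => h (by rw [e, Int.cast_zero])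
  obtain ⟨k1, k2, -, -⟩ := treeGaugeAt_bondInd_ne_zero_blk hN hr hz j
  have a1 := zsmul_blk_le hN p j
  have a2 := lt_zsmul_blk_add hN p j
  have hle : |p j - z j| ≤ (N : ℤ) - 1 := abs_le.mpr ⟨by omega, by omega⟩
  omega

/-- [folklore] … and so does its block mean. -/
theorem blockMeanAt_treeGaugeAt_delta1_eq_zero (hN : 1 ≤ N) {r : Fin (d + 1) → ℕ} (hr : r ∈ box (d + 1) N) {β : Fin (d + 1)}
    {z p : Fin (d + 1) → ℤ} {j : Fin (d + 1)} (hj : (N : ℤ) ≤ |p j - z j|) :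
    blockMeanAt N (treeGaugeAt (toSite r) (delta1 β z) N) p = 0 := by
  unfold AxialProjectorBlockMean.blockMeanAt
  rw [← bondInd_cast_eq_delta1]
  by_contra h
  have hbs : blockSum N (treeGaugeAt (toSite r) (fun κ w => (bondInd β z κ w : ℝ)) N) (blk N p) ≠ 0 := by
    intro e
    apply h
    rw [e, zero_div]
  obtain ⟨k1, k2, -, -⟩ := blockSum_treeGaugeAt_bondInd_ne_zero hN hr hbs j
  have a1 := zsmul_blk_le hN p j
  have a2 := lt_zsmul_blk_add hN p j
  have hle : |p j - z j| ≤ (N : ℤ) - 1 := abs_le.mpr ⟨by omega, by omega⟩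
  omega

/-- [folklore] **THE DRESSING POTENTIAL `λ = bmGaugeAt ρ δ_{(β,z)} N` VANISHES AT `ℓ^∞`-DISTANCE `≥ N` FROM THE BOND** (in-block root). -/
theorem bmGaugeAt_delta1_eq_zero (hN : 1 ≤ N) {r : Fin (d + 1) → ℕ} (hr : r ∈ box (d + 1) N) {β : Fin (d + 1)}
    {z p : Fin (d + 1) → ℤ} {j : Fin (d + 1)} (hj : (N : ℤ) ≤ |p j - z j|) :
    bmGaugeAt (toSite r) (delta1 β z) N p = 0 := by
  unfold AxialProjectorBlockMean.bmGaugeAt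
  rw [Pi.sub_apply, treeGaugeAt_delta1_eq_zero hN hr hj, blockMeanAt_treeGaugeAt_delta1_eq_zero hN hr hj, sub_zero]

/-- [folklore] **THE DRESSING POTENTIAL OF A BOND INDICATOR IS SUMMABLE** (finitely supported; in-block root). -/
theorem summable_bmGaugeAt_delta1 (hN : 1 ≤ N) {r : Fin (d + 1) → ℕ} (hr : r ∈ box (d + 1) N) (β : Fin (d + 1))
    (z : Fin (d + 1) → ℤ) : Summable (bmGaugeAt (toSite r) (delta1 β z) N) := by
  refine summable_of_ne_finset_zero (s := Fintype.piFinset fun j : Fin (d + 1) => Finset.Icc (z j - N) (z j + N))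
    fun p hp => ?_
  rw [Fintype.mem_piFinset] at hp
  obtain ⟨j, hj⟩ := not_forall.mp hp
  rw [Finset.mem_Icc, not_and_or, not_le, not_le] at hj
  apply bmGaugeAt_delta1_eq_zero hN hr (j := j)
  rw [le_abs]
  rcases hj with h | h
  · right; linarith
  · left; linarith

end Potential

/-! ## §4 A bounded co-closed coarse row is reproduced by the field block of `Π̂_bm` -/

section Row

variable {L : ℕ}

/-- [folklore] **REPRODUCTION OF A BOUNDED CO-CLOSED ROW BY THE FIELD BLOCK OF `Π̂_bm`** (in-block root, `L ≥ 1`):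
`∑'_y ∑_l A_l(y) · piKBm ρ L z y (inl β) (inl l) = A_β(z)` — the column is `δ_{(β,z)} − d(bmGaugeAt ρ δ_{(β,z)} L)` and the exact part
pairs to zero with `A` (§2, §3). -/
theorem tsum_mul_piKBm_inl_inl (hL : 1 ≤ L) {r : Fin (d + 1) → ℕ} (hr : r ∈ box (d + 1) L) {A : Form1 (d + 1) ℝ} {C : ℝ}
    (hA : ∀ l y, |A l y| ≤ C) (hco : codiff₁ A = 0) (z : Fin (d + 1) → ℤ) (β : Fin (d + 1)) :
    ∑' y, ∑ l, A l y * piKBm (toSite r) L z y (Sum.inl β) (Sum.inl l) = A β z := by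
  have e : ∀ (y : Fin (d + 1) → ℤ) (l : Fin (d + 1)), piKBm (toSite r) L z y (Sum.inl β) (Sum.inl l) =
      delta1 β z l y - dz (bmGaugeAt (toSite r) (delta1 β z) L) l y := by
    intro y l
    rw [piKBm_inl_inl_eq hL hr]
    unfold AxialProjectorBlockMean.axProjBmAt
    rw [grad_eq_dz]
    rfl
  simp_rw [e, mul_sub, Finset.sum_sub_distrib]
  have hδ : ∀ y, y ≠ z → ∑ l, A l y * delta1 β z l y = 0 := fun y hy =>
    Finset.sum_eq_zero fun l _ => by rw [delta1_apply, if_neg (fun h => hy h.2), mul_zero]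
  have hs1 : Summable fun y => ∑ l, A l y * delta1 β z l y :=
    summable_of_ne_finset_zero (s := {z}) fun y hy => hδ y (by rwa [Finset.mem_singleton] at hy)
  have hg := summable_bmGaugeAt_delta1 hL hr β z
  have hs2 : Summable fun y => ∑ l, A l y * dz (bmGaugeAt (toSite r) (delta1 β z) L) l y :=
    summable_sum fun l _ => summable_mul_of_bdd (hA l) (summable_dz hg l)
  rw [hs1.tsum_sub hs2, tsum_mul_dz_eq_zero_of_codiff₁ hA hco hg, sub_zero, tsum_eq_single z hδ,
    Finset.sum_eq_single β (fun l _ hl => by rw [delta1_apply, if_neg (fun h => hl h.1), mul_zero])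
      (fun h => (h (Finset.mem_univ β)).elim),
    delta1_apply, if_pos ⟨rfl, rfl⟩, mul_one]

end Row

/-! ## §5 The value Hessian `E2 d Lc j` is blind to the block-mean dressing on both sides -/

section E2Blind

variable {Lc : ℕ} [NeZero Lc]

/-- [folklore] The field–field entry of the value Hessian IS the multiplier response of the level-`Lc^j` resolvent:
`E2 d Lc j x′ z′ (inl κ) (inl l) = wΦ (N := Lc^j) κ l (x′ − z′)`. -/
theorem E2_inl_inl_eq_wΦ (j : ℕ) (x' z' : Fin (d + 1) → ℤ) (κ l : Fin (d + 1)) :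
    E2 d Lc j x' z' (Sum.inl κ) (Sum.inl l) = wΦ (N := Lc ^ j) κ l (x' - z') := by
  unfold BalabanStepJetsSucc.E2
  rw [mmRead_inl_inl, KInv_inr_inr_coarse]

/-- [folklore] The field–multiplier entries of the value Hessian vanish. -/
theorem E2_inl_inr (j : ℕ) (x' z' : Fin (d + 1) → ℤ) (κ m : Fin (d + 1)) :
    E2 d Lc j x' z' (Sum.inl κ) (Sum.inr m) = 0 := by
  unfold BalabanStepJetsSucc.E2
  exact mmRead_inr_right _ _ _ _ _ _

/-- [folklore] The multiplier rows of the value Hessian vanish. -/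
theorem E2_inr (j : ℕ) (x' z' : Fin (d + 1) → ℤ) (m : Fin (d + 1)) (b : Fib d) :
    E2 d Lc j x' z' (Sum.inr m) b = 0 := by
  unfold BalabanStepJetsSucc.E2
  exact mmRead_inr_left _ _ _ _ _ _

/-- [folklore] The action of the value Hessian on a kernel, field rows: a convolution of the field column with `wΦ`. -/
theorem comp_E2_apply_inl (j : ℕ) (K : MKer (d + 1) (Fib d)) (x z : Fin (d + 1) → ℤ) (κ : Fin (d + 1)) (b : Fib d) :
    comp (E2 d Lc j) K x z (Sum.inl κ) b = ∑' y, ∑ l, wΦ (N := Lc ^ j) κ l (x - y) * K y z (Sum.inl l) b := by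
  unfold ExpKernelCalculus.comp
  refine tsum_congr fun y => ?_
  rw [Fintype.sum_sum_type]
  simp only [E2_inl_inl_eq_wΦ, E2_inl_inr, zero_mul, Finset.sum_const_zero, add_zero]

/-- [folklore] The action of the value Hessian on a kernel, multiplier rows: zero. -/
theorem comp_E2_apply_inr (j : ℕ) (K : MKer (d + 1) (Fib d)) (x z : Fin (d + 1) → ℤ) (m : Fin (d + 1)) (b : Fib d) :
    comp (E2 d Lc j) K x z (Sum.inr m) b = 0 := by
  unfold ExpKernelCalculus.comp
  simp only [E2_inr, zero_mul, Finset.sum_const_zero, tsum_zero]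

/-- [folklore] **RIGHT BLINDNESS OF THE VALUE HESSIAN TO THE BLOCK-MEAN DRESSING**: `comp (E2 d Lc j) (trK (piKBm (toSite r) Lc)) = E2 d Lc j`
(every `j`, every in-block root `r`). -/
theorem comp_E2_trK_piKBm {r : Fin (d + 1) → ℕ} (hr : r ∈ box (d + 1) Lc) (j : ℕ) :
    comp (E2 d Lc j) (trK (piKBm (toSite r) Lc)) = E2 d Lc j := by
  have hLc : 1 ≤ Lc := one_le_of_neZero Lc
  obtain ⟨C, hC⟩ := exists_abs_wΦ_le (N := Lc ^ j) (d := d)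
  funext x z a b
  rcases a with κ | m
  · rw [comp_E2_apply_inl]
    rcases b with β | m
    · simp only [trK_apply]
      rw [tsum_mul_piKBm_inl_inl hLc hr (A := fun l y => wΦ (N := Lc ^ j) κ l (x - y)) (fun l y => hC κ l (x - y))
        (codiff₁_wΦ_right κ x) z β, E2_inl_inl_eq_wΦ]
    · simp only [trK_apply, piKBm_inr_inl, mul_zero, Finset.sum_const_zero, tsum_zero, E2_inl_inr]
  · rw [comp_E2_apply_inr, E2_inr]

/-- [folklore] **LEFT BLINDNESS OF THE VALUE HESSIAN TO THE BLOCK-MEAN DRESSING**: `comp (piKBm (toSite r) Lc) (E2 d Lc j) = E2 d Lc j`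
(every `j`, every in-block root `r`; first-slot co-closedness, no symmetry needed). -/
theorem comp_piKBm_E2 {r : Fin (d + 1) → ℕ} (hr : r ∈ box (d + 1) Lc) (j : ℕ) :
    comp (piKBm (toSite r) Lc) (E2 d Lc j) = E2 d Lc j := by
  have hLc : 1 ≤ Lc := one_le_of_neZero Lc
  obtain ⟨C, hC⟩ := exists_abs_wΦ_le (N := Lc ^ j) (d := d)
  funext x z a b
  unfold ExpKernelCalculus.comp
  rcases a with α | m
  · rcases b with β | m'
    · have e : ∀ y, ∑ f : Fib d, piKBm (toSite r) Lc x y (Sum.inl α) f * E2 d Lc j y z f (Sum.inl β) =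
          ∑ l, (fun l y => wΦ (N := Lc ^ j) l β (y - z)) l y * piKBm (toSite r) Lc x y (Sum.inl α) (Sum.inl l) := by
        intro y
        rw [Fintype.sum_sum_type]
        simp only [piKBm_inl_inr, zero_mul, Finset.sum_const_zero, add_zero, E2_inl_inl_eq_wΦ]
        exact Finset.sum_congr rfl fun l _ => mul_comm _ _
      rw [tsum_congr e, tsum_mul_piKBm_inl_inl hLc hr (A := fun l y => wΦ (N := Lc ^ j) l β (y - z))
        (fun l y => hC l β (y - z)) (codiff₁_wΦ_shift β z) x α, E2_inl_inl_eq_wΦ]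
    · have e : ∀ y, ∑ f : Fib d, piKBm (toSite r) Lc x y (Sum.inl α) f * E2 d Lc j y z f (Sum.inr m') = 0 := by
        intro y
        rw [Fintype.sum_sum_type]
        simp only [piKBm_inl_inr, zero_mul, Finset.sum_const_zero, add_zero, E2_inl_inr, mul_zero]
      rw [tsum_congr e, tsum_zero, E2_inl_inr]
  · have e : ∀ y, ∑ f : Fib d, piKBm (toSite r) Lc x y (Sum.inr m) f * E2 d Lc j y z f b = 0 := by
      intro y
      rw [Fintype.sum_sum_type]
      simp only [piKBm_inr_inl, zero_mul, Finset.sum_const_zero, zero_add, E2_inr, mul_zero]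
    rw [tsum_congr e, tsum_zero, E2_inr]

end E2Blind

end

end Summit.QuantumFields.BalabanUV.Beta.BorderedHessian
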